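import Summits.QuantumFields.GaugeBoot.SU2PairInversion
import HarnessLib

/-!
# Pair inversion changes traces in `SU(3)`: an explicit pair over `ℚ(i)`
# (gauge-boot, large-`N` supplement 17, part 5 — sharpness of parts 1–3 in the rank)

HONEST FRAMING (cell `pub-gaugeboot`, page 1 of every file): the venture produces certified bounds
on lattice expectations at stated coupling, gauge group, dimension and torus size; NOT a mass gap,
NOT a continuum limit, NOT a string tension; NOT large `N` unless marked CONDITIONAL; NOT
Yang–Mills-summit-bearing (barriers `FixedCouplingUltralocality`, `PerturbativeInvisibility`).
Exact rational matrix arithmetic; this file certifies no number.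

## Content

Part 1 (`SU2PairInversion.trace_lift_inv`): over `SU(2)`, `tr w(A⁻¹, B⁻¹) = tr w(A, B)` for every
`w ∈ F₂`.  This fails in `SU(3)` already for the length-`5` word `w = a²ba⁻¹b⁻¹` of part 3:

* `matX = diag(i, −i, 1) · R`, `R` the rotation by `arccos(3/5)` in the `(2,3)`-plane, and the cyclic
  permutation matrix `matY`, both in `SU(3)` with entries in `ℚ(i)` (`matX_mem`, `matY_mem`);
* ★★ `re_trace_pair_inversion_ne` — `Re tr (X²YX⁻¹Y⁻¹) = 53/125 ≠ −43/125 = Re tr (X⁻²Y⁻¹XY)`: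
  **simultaneous inversion of a pair is not a symmetry of `SU(3)` loop variables**, so the
  identities of parts 2–3 are specific to `N = 2` (and to two loops, part 1 `trace_three_ne`);
  `exists_re_trace_lift_inv_ne` — the same in the `FreeGroup.lift` form of part 1.

Numerically (not formalised) the two `ℤ²` loops `c₁, c₂` of part 3 have different `SU(3)` Wilson loop
expectations as well; for `SU(3)` the sporadic single-trace coincidence
`Re tr(A²BAB⁻¹) = Re tr(A²B⁻¹AB)` DOES hold — it is a two-row consequence of the lane's Cayley–Hamilton
pair identity `SU3PairIdentity.su_three_pair_identity` (T1) and is not restated here.  [folklore]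
-/

noncomputable section

open Matrix

namespace Summit.QuantumFields.GaugeBoot

namespace SU3PairInversionFails

/-- `X = diag(i, −i, 1) · R₂₃(arccos 3/5)`, entries in `ℚ(i)`. [folklore] -/
def matX : Matrix (Fin 3) (Fin 3) ℂ := !![(⟨0, 1⟩ : ℂ), (0 : ℂ), (0 : ℂ); (0 : ℂ), (⟨0, -3/5⟩ : ℂ), (⟨0, -4/5⟩ : ℂ); (0 : ℂ), (-4/5 : ℂ), (3/5 : ℂ)]

/-- The cyclic permutation matrix. [folklore] -/
def matY : Matrix (Fin 3) (Fin 3) ℂ := !![(0 : ℂ), (1 : ℂ), (0 : ℂ); (0 : ℂ), (0 : ℂ), (1 : ℂ); (1 : ℂ), (0 : ℂ), (0 : ℂ)]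

/-- `X⋆`. [folklore] -/
theorem star_matX : star matX = !![(⟨0, -1⟩ : ℂ), (0 : ℂ), (0 : ℂ); (0 : ℂ), (⟨0, 3/5⟩ : ℂ), (-4/5 : ℂ); (0 : ℂ), (⟨0, 4/5⟩ : ℂ), (3/5 : ℂ)] := by
  ext i j
  fin_cases i <;> fin_cases j <;> simp [matX, Matrix.star_apply, Complex.ext_iff] <;> norm_num

/-- `Y⋆ = Yᵀ`. [folklore] -/
theorem star_matY : star matY = !![(0 : ℂ), (0 : ℂ), (1 : ℂ); (1 : ℂ), (0 : ℂ), (0 : ℂ); (0 : ℂ), (1 : ℂ), (0 : ℂ)] := by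
  ext i j
  fin_cases i <;> fin_cases j <;> simp [matY, Matrix.star_apply]

/-- `X ∈ SU(3)`. [folklore] -/
theorem matX_mem : matX ∈ Matrix.specialUnitaryGroup (Fin 3) ℂ := by
  rw [Matrix.mem_specialUnitaryGroup_iff, Matrix.mem_unitaryGroup_iff, star_matX]
  refine ⟨?_, ?_⟩
  · ext i j
    fin_cases i <;> fin_cases j <;> simp [matX, Matrix.mul_apply, Fin.sum_univ_three, Complex.ext_iff] <;> norm_num
  · simp [matX, Matrix.det_fin_three, Complex.ext_iff]
    norm_num

/-- `Y ∈ SU(3)`. [folklore] -/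
theorem matY_mem : matY ∈ Matrix.specialUnitaryGroup (Fin 3) ℂ := by
  rw [Matrix.mem_specialUnitaryGroup_iff, Matrix.mem_unitaryGroup_iff, star_matY]
  refine ⟨?_, ?_⟩
  · ext i j
    fin_cases i <;> fin_cases j <;> simp [matY, Matrix.mul_apply, Fin.sum_univ_three]
  · simp [matY, Matrix.det_fin_three]

/-- `X` as an element of `SU 3`. [folklore] -/
def elX : SU 3 := ⟨matX, matX_mem⟩

/-- `Y` as an element of `SU 3`. [folklore] -/
def elY : SU 3 := ⟨matY, matY_mem⟩

/-- `X⋆Y⋆`. [folklore] -/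
theorem prod_d1 : star matX * star matY = !![(0 : ℂ), (0 : ℂ), (⟨0, -1⟩ : ℂ); (⟨0, 3/5⟩ : ℂ), (-4/5 : ℂ), (0 : ℂ); (⟨0, 4/5⟩ : ℂ), (3/5 : ℂ), (0 : ℂ)] := by
  rw [star_matX, star_matY]
  ext i j
  fin_cases i <;> fin_cases j <;> simp [Matrix.mul_apply, Fin.sum_univ_three]

/-- `Y X⋆ Y⋆`. [folklore] -/
theorem prod_d2 : matY * (star matX * star matY) = !![(⟨0, 3/5⟩ : ℂ), (-4/5 : ℂ), (0 : ℂ); (⟨0, 4/5⟩ : ℂ), (3/5 : ℂ), (0 : ℂ); (0 : ℂ), (0 : ℂ), (⟨0, -1⟩ : ℂ)] := by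
  rw [prod_d1]
  ext i j
  fin_cases i <;> fin_cases j <;> simp [matY, Matrix.mul_apply, Fin.sum_univ_three]

/-- `X Y X⋆ Y⋆`. [folklore] -/
theorem prod_d3 : matX * (matY * (star matX * star matY)) = !![(-3/5 : ℂ), (⟨0, -4/5⟩ : ℂ), (0 : ℂ); (12/25 : ℂ), (⟨0, -9/25⟩ : ℂ), (-4/5 : ℂ); (⟨0, -16/25⟩ : ℂ), (-12/25 : ℂ), (⟨0, -3/5⟩ : ℂ)] := by
  rw [prod_d2]
  ext i j
  fin_cases i <;> fin_cases j <;> simp [matX, Matrix.mul_apply, Fin.sum_univ_three, Complex.ext_iff] <;> norm_num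

/-- `X² Y X⋆ Y⋆`. [folklore] -/
theorem prod_d4 : matX * (matX * (matY * (star matX * star matY))) = !![(⟨0, -3/5⟩ : ℂ), (4/5 : ℂ), (0 : ℂ); (⟨-64/125, -36/125⟩ : ℂ), (⟨-27/125, 48/125⟩ : ℂ), (⟨-12/25, 12/25⟩ : ℂ); (⟨-48/125, -48/125⟩ : ℂ), (⟨-36/125, 36/125⟩ : ℂ), (⟨16/25, -9/25⟩ : ℂ)] := by
  rw [prod_d3]
  ext i j
  fin_cases i <;> fin_cases j <;> simp [matX, Matrix.mul_apply, Fin.sum_univ_three, Complex.ext_iff] <;> norm_num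

/-- `X Y`. [folklore] -/
theorem prod_e1 : matX * matY = !![(0 : ℂ), (⟨0, 1⟩ : ℂ), (0 : ℂ); (⟨0, -4/5⟩ : ℂ), (0 : ℂ), (⟨0, -3/5⟩ : ℂ); (3/5 : ℂ), (0 : ℂ), (-4/5 : ℂ)] := by
  ext i j
  fin_cases i <;> fin_cases j <;> simp [matX, matY, Matrix.mul_apply, Fin.sum_univ_three]

/-- `Y⋆ X Y`. [folklore] -/
theorem prod_e2 : star matY * (matX * matY) = !![(3/5 : ℂ), (0 : ℂ), (-4/5 : ℂ); (0 : ℂ), (⟨0, 1⟩ : ℂ), (0 : ℂ); (⟨0, -4/5⟩ : ℂ), (0 : ℂ), (⟨0, -3/5⟩ : ℂ)] := by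
  rw [prod_e1, star_matY]
  ext i j
  fin_cases i <;> fin_cases j <;> simp [Matrix.mul_apply, Fin.sum_univ_three]

/-- `X⋆ Y⋆ X Y`. [folklore] -/
theorem prod_e3 : star matX * (star matY * (matX * matY)) = !![(⟨0, -3/5⟩ : ℂ), (0 : ℂ), (⟨0, 4/5⟩ : ℂ); (⟨0, 16/25⟩ : ℂ), (-3/5 : ℂ), (⟨0, 12/25⟩ : ℂ); (⟨0, -12/25⟩ : ℂ), (-4/5 : ℂ), (⟨0, -9/25⟩ : ℂ)] := by
  rw [prod_e2, star_matX]
  ext i j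
  fin_cases i <;> fin_cases j <;> simp [Matrix.mul_apply, Fin.sum_univ_three, Complex.ext_iff] <;> norm_num

/-- `X⋆² Y⋆ X Y`. [folklore] -/
theorem prod_e4 : star matX * (star matX * (star matY * (matX * matY))) = !![(-3/5 : ℂ), (0 : ℂ), (4/5 : ℂ); (⟨-48/125, 48/125⟩ : ℂ), (⟨16/25, -9/25⟩ : ℂ), (⟨-36/125, 36/125⟩ : ℂ); (⟨-64/125, -36/125⟩ : ℂ), (⟨-12/25, -12/25⟩ : ℂ), (⟨-48/125, -27/125⟩ : ℂ)] := by
  rw [prod_e3, star_matX]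
  ext i j
  fin_cases i <;> fin_cases j <;> simp [Matrix.mul_apply, Fin.sum_univ_three, Complex.ext_iff] <;> norm_num

/-- `Re tr (X² Y X⁻¹ Y⁻¹) = 53/125`. [folklore] -/
theorem re_trace_word : (matX * (matX * (matY * (star matX * star matY)))).trace.re = 53 / 125 := by
  rw [prod_d4, Matrix.trace_fin_three]
  simp
  norm_num

/-- `Re tr (X⁻² Y⁻¹ X Y) = −43/125`. [folklore] -/
theorem re_trace_invWord : (star matX * (star matX * (star matY * (matX * matY)))).trace.re = -43 / 125 := by
  rw [prod_e4, Matrix.trace_fin_three]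
  simp
  norm_num

/-- ★★ **Pair inversion is not a trace symmetry in `SU(3)`**: for `X, Y` above and `w = a²ba⁻¹b⁻¹`,
`Re tr w(X,Y) = 53/125 ≠ −43/125 = Re tr w(X⁻¹,Y⁻¹)` — even the REAL parts (the loop variables) differ.
[folklore] -/
theorem re_trace_pair_inversion_ne :
    ((elX * (elX * (elY * (elX⁻¹ * elY⁻¹))) : SU 3) : Matrix (Fin 3) (Fin 3) ℂ).trace.re ≠
      ((elX⁻¹ * (elX⁻¹ * (elY⁻¹ * (elX * elY))) : SU 3) : Matrix (Fin 3) (Fin 3) ℂ).trace.re := by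
  show (matX * (matX * (matY * (star matX * star matY)))).trace.re ≠
    (star matX * (star matX * (star matY * (matX * matY)))).trace.re
  rw [re_trace_word, re_trace_invWord]
  norm_num

/-- The same in the `FreeGroup.lift` form of part 1: with `f = (X, Y)` and the letter list of
`a²ba⁻¹b⁻¹`, `Re tr (lift f⁻¹ w) ≠ Re tr (lift f w)` — the hypothesis `N = 2` of
`SU2PairInversion.trace_lift_inv` cannot be dropped. [folklore] -/
theorem exists_re_trace_lift_inv_ne : ∃ f : Fin 2 → SU 3, ∃ w : FreeGroup (Fin 2),
    ((FreeGroup.lift (fun i => (f i)⁻¹) w : SU 3) : Matrix (Fin 3) (Fin 3) ℂ).trace.re ≠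
      ((FreeGroup.lift f w : SU 3) : Matrix (Fin 3) (Fin 3) ℂ).trace.re := by
  refine ⟨![elX, elY], FreeGroup.mk [(0, true), (0, true), (1, true), (0, false), (1, false)], ?_⟩
  simp only [FreeGroup.lift_mk, List.map_cons, List.map_nil, List.prod_cons, List.prod_nil, mul_one, cond_true,
    cond_false, inv_inv, Matrix.cons_val_zero, Matrix.cons_val_one]
  exact fun h => re_trace_pair_inversion_ne h.symm

end SU3PairInversionFails

end Summit.QuantumFields.GaugeBoot

end
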